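import Summits.HubbardSuperconductivity.HubbardSuperconductivity.Theorems.BalabanIRBirEveryGroundStateMoments
import Summits.HubbardSuperconductivity.HubbardSuperconductivity.Theorems.BalabanIRBirEveryGroundStateSchur

/-!
# Route `BalabanIR`, crux 5 `BirEveryGroundState` (item `stmt-HubbardSuperconductivity-2083`):
# Samuelson's inequality for the compression — the sharp moment endgame

Sharp form of `compressionVarianceHeadCount` / `forall_unit_le_re_of_moments` with the
`(m - 1)/m` factor of Samuelson's deviation inequality, which is what the crux file
`Cruxes/BirEveryGroundState/RESHAPE-ideator1.md` types (`SamuelsonMinBound`, clause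
`ε (D - 1) ≤ 1/4`): for Hermitian `Y`, a subspace `K ≠ ⊥` with projection `P`
(`m = re tr P`), tracial mean `ȳ = re tr (P Y)/m` and every unit `ψ ∈ K`,

  `m · (re ⟨ψ, Y ψ⟩ - ȳ)² ≤ (m - 1) · (re tr (P Y P Y) - m ȳ²)`        (`samuelsonHeadCount`),

i.e. `|⟨Y⟩_ψ - ȳ| ≤ √(m - 1) σ`, `σ²` the tracial variance of the compression (`samuelson_core`:
`D = P Y P - ȳ P`, `Q = P - |ψ⟩⟨ψ|`, `tr D² = tr (Q D Q D) + 2 ‖Q D ψ‖² + ⟨ψ, D ψ⟩²` and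
`⟨ψ, D ψ⟩² = |tr (Q D Q)|² ≤ (m - 1) tr (Q D Q D)` by the Frobenius Cauchy–Schwarz inequality).
Consequences: `forall_unit_le_re_of_moments'` (clause `ε (D - 1) ≤ 1/4`) and the Hubbard
closures `hasLRO_of_groundState_moments'`, `birEveryGroundState_of_moments'`.
Samuelson, *How deviant can you be?*, JASA 63 (1968) 1522; Bhatia, *Matrix Analysis* §I.2.
Everything is folklore; no definition is introduced.
-/

noncomputable section

namespace Summit.HubbardSuperconductivity.HubbardSuperconductivity.Theorems

open Matrix Finset Filter
open Literature.Probability.LatticeModels Literature.MathematicalPhysics.QuantumLattice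
open Summit.HubbardSuperconductivity.HubbardSuperconductivity.Theses.BalabanIR
open scoped ComplexOrder

section Samuelson

variable {n : Type*} [Fintype n]

/-- **Cauchy–Schwarz for the Frobenius inner product**: `|tr (Aᴴ B)|² ≤ re tr (Aᴴ A) · re tr (Bᴴ B)`
(flatten the matrices to vectors of `ℓ²(n × n)`). Bhatia, *Matrix Analysis* §I.2. [folklore] -/
theorem norm_sq_trace_conjTranspose_mul_le (A B : Matrix n n ℂ) :
    ‖(Aᴴ * B).trace‖ ^ 2 ≤ (Aᴴ * A).trace.re * (Bᴴ * B).trace.re := by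
  -- flatten
  set a : n × n → ℂ := fun p => A p.1 p.2 with ha
  set b : n × n → ℂ := fun p => B p.1 p.2 with hb
  have htr : ∀ (X Y : Matrix n n ℂ), (Xᴴ * Y).trace =
      star (fun p : n × n => X p.1 p.2) ⬝ᵥ (fun p : n × n => Y p.1 p.2) := by
    intro X Y
    simp only [Matrix.trace, Matrix.diag_apply, Matrix.mul_apply, conjTranspose_apply, dotProduct,
      Pi.star_apply]
    rw [Fintype.sum_prod_type, Finset.sum_comm]
  rw [htr A B, htr A A, htr B B, ← norm_toLp_sq_eq_re, ← norm_toLp_sq_eq_re, star_dotProduct_eq_inner,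
    ← mul_pow]
  exact pow_le_pow_left₀ (norm_nonneg _) (norm_inner_le_norm _ _) 2

variable [DecidableEq n]

/-- **Samuelson's inequality, core matrix form.** Let `P` be a Hermitian idempotent, `D` a
Hermitian matrix with `P D = D = D P` and `tr D = 0`, and `ψ` a unit vector with `P ψ = ψ`. Then
`re tr P · (re ⟨ψ, D ψ⟩)² ≤ (re tr P - 1) · re tr (D D)`. (With `E = |ψ⟩⟨ψ|`, `Q = P - E`:
`tr D² = tr (Q D Q D) + 2 ‖Q D ψ‖² + ⟨ψ, D ψ⟩²`, and `⟨ψ, D ψ⟩² = |tr (Q D Q)|² ≤ (re tr P - 1) ·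
tr (Q D Q D)` by the Frobenius Cauchy–Schwarz inequality.) Samuelson, JASA 63 (1968) 1522.
[folklore] -/
theorem samuelson_core {P D : Matrix n n ℂ} (hPH : Pᴴ = P) (hPP : P * P = P) (hDH : Dᴴ = D)
    (hPD : P * D = D) (htr : D.trace = 0) {ψ : n → ℂ} (hPψ : P *ᵥ ψ = ψ)
    (hψ : star ψ ⬝ᵥ ψ = 1) :
    P.trace.re * (star ψ ⬝ᵥ D *ᵥ ψ).re ^ 2 ≤ (P.trace.re - 1) * (D * D).trace.re := by
  -- the rank-one projection `E = |ψ⟩⟨ψ|` and `Q = P - E`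
  set E : Matrix n n ℂ := vecMulVec ψ (star ψ) with hE
  set Q : Matrix n n ℂ := P - E with hQ
  set a : ℂ := star ψ ⬝ᵥ D *ᵥ ψ with ha
  have hDP : D * P = D := by
    calc D * P = (P * D)ᴴ := by rw [conjTranspose_mul, hPH, hDH]
      _ = D := by rw [hPD, hDH]
  have hψP : star ψ ᵥ* P = star ψ := by
    conv_lhs => rw [← hPH]
    rw [vecMul_conjTranspose, star_star, hPψ]
  have hEE : E * E = E := by rw [hE, vecMulVec_mul_vecMulVec, hψ, one_smul]
  have hEH : Eᴴ = E := by rw [hE, conjTranspose_vecMulVec, star_star]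
  have hPE : P * E = E := by rw [hE, mul_vecMulVec, hPψ]
  have hEP : E * P = E := by rw [hE, vecMulVec_mul, hψP]
  have htrE : E.trace = 1 := by rw [hE, trace_vecMulVec, dotProduct_comm, hψ]
  have htrEM : ∀ M : Matrix n n ℂ, (E * M).trace = star ψ ⬝ᵥ M *ᵥ ψ := fun M => by
    rw [hE, vecMulVec_mul, trace_vecMulVec, dotProduct_comm, dotProduct_mulVec]
  have htrEMEN : ∀ M N : Matrix n n ℂ,
      (E * M * (E * N)).trace = (star ψ ⬝ᵥ M *ᵥ ψ) * (star ψ ⬝ᵥ N *ᵥ ψ) := fun M N => by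
    rw [hE, vecMulVec_mul ψ (star ψ) M, vecMulVec_mul ψ (star ψ) N, vecMulVec_mul_vecMulVec,
      trace_vecMulVec, dotProduct_smul, smul_eq_mul, ← dotProduct_mulVec, dotProduct_comm ψ,
      ← dotProduct_mulVec]
  -- `Q` is a Hermitian idempotent of trace `re tr P - 1 ≥ 0`
  have hQH : Qᴴ = Q := by rw [hQ, conjTranspose_sub, hPH, hEH]
  have hQQ : Q * Q = Q := by
    rw [hQ, sub_mul, mul_sub, mul_sub, hPP, hPE, hEP, hEE, sub_self, sub_zero]
  have htrQ : Q.trace.re = P.trace.re - 1 := by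
    rw [hQ, trace_sub, htrE, Complex.sub_re, Complex.one_re]
  have htrQ0 : 0 ≤ Q.trace.re := by
    have h : Q = Qᴴ * Q := by rw [hQH, hQQ]
    rw [h, re_trace_conjTranspose_mul_self_eq_sum]
    positivity
  -- `a` is real
  have ha_im : a.im = 0 := by
    have h : star a = a := by
      rw [ha]
      conv_lhs => rw [star_dotProduct, star_star, star_mulVec, hDH, ← dotProduct_mulVec]
    rw [Complex.star_def] at h
    exact Complex.conj_eq_iff_im.mp h
  -- (1) decomposition of `tr (D D)`
  have hdecomp : (D * D).trace = (Q * D * (Q * D)).trace + 2 * (star ψ ⬝ᵥ (D * Q * D) *ᵥ ψ) +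
      a * a := by
    have hP : P = Q + E := by rw [hQ, sub_add_cancel]
    have h1 : D * D = (P * D) * (P * D) := by rw [hPD]
    have t1 : (E * D * (Q * D)).trace = star ψ ⬝ᵥ (D * Q * D) *ᵥ ψ := by
      rw [show E * D * (Q * D) = E * (D * Q * D) by simp only [Matrix.mul_assoc], htrEM]
    have t2 : (Q * D * (E * D)).trace = star ψ ⬝ᵥ (D * Q * D) *ᵥ ψ := by
      rw [trace_mul_comm, t1]
    rw [h1, hP]
    simp only [add_mul, mul_add, trace_add]
    rw [t1, t2, htrEMEN, ← ha]
    ring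
  -- (2) `⟨ψ, D Q D ψ⟩ = ‖Q D ψ‖² ≥ 0`
  set φ : n → ℂ := D *ᵥ ψ with hφ
  have hadjD : ∀ w, star ψ ⬝ᵥ D *ᵥ w = star φ ⬝ᵥ w := fun w => by
    rw [hφ, star_mulVec_dotProduct, hDH]
  have hbeq : star ψ ⬝ᵥ (D * Q * D) *ᵥ ψ = star (Q *ᵥ φ) ⬝ᵥ (Q *ᵥ φ) := by
    calc star ψ ⬝ᵥ (D * Q * D) *ᵥ ψ = star ψ ⬝ᵥ D *ᵥ (Q *ᵥ φ) := by
          rw [← mulVec_mulVec, ← mulVec_mulVec]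
      _ = star φ ⬝ᵥ Q *ᵥ φ := hadjD _
      _ = star (Q *ᵥ φ) ⬝ᵥ (Q *ᵥ φ) := by
          conv_rhs => rw [star_mulVec_dotProduct, hQH, mulVec_mulVec, hQQ]
  have hb : 0 ≤ (star ψ ⬝ᵥ (D * Q * D) *ᵥ ψ).re := by
    rw [hbeq, re_star_dotProduct_self_eq_sum]
    positivity
  -- (3) Cauchy–Schwarz: `|a|² = |tr (Q D Q)|² ≤ (re tr P - 1) · re tr (Q D Q D)`
  have hQDQH : (Q * D * Q)ᴴ = Q * D * Q := by
    rw [conjTranspose_mul, conjTranspose_mul, hQH, hDH, Matrix.mul_assoc]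
  have htrQD : (Q * D).trace = -a := by
    rw [hQ, sub_mul, trace_sub, hPD, htr, htrEM, ← ha, zero_sub]
  have hCS : ‖a‖ ^ 2 ≤ (P.trace.re - 1) * (Q * D * (Q * D)).trace.re := by
    have h := norm_sq_trace_conjTranspose_mul_le Q (Q * D * Q)
    have e1 : Qᴴ * (Q * D * Q) = Q * D * Q := by
      rw [hQH, ← Matrix.mul_assoc, ← Matrix.mul_assoc, hQQ]
    have e2 : (Q * D * Q).trace = -a := by
      rw [trace_mul_comm, ← Matrix.mul_assoc, hQQ, htrQD]
    have e3 : Qᴴ * Q = Q := by rw [hQH, hQQ]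
    have e4 : (Q * D * Q)ᴴ * (Q * D * Q) = Q * D * Q * D * Q := by
      rw [hQDQH, show Q * D * Q * (Q * D * Q) = Q * D * (Q * Q) * D * Q by
        simp only [Matrix.mul_assoc], hQQ]
    have e5 : (Q * D * Q * D * Q).trace = (Q * D * (Q * D)).trace := by
      rw [trace_mul_comm, ← Matrix.mul_assoc, ← Matrix.mul_assoc, ← Matrix.mul_assoc, hQQ,
        Matrix.mul_assoc]
    rw [e1, e2, e3, e4, e5, norm_neg, htrQ] at h
    exact h
  -- (4) real parts
  have hV : (D * D).trace.re = (Q * D * (Q * D)).trace.re +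
      2 * (star ψ ⬝ᵥ (D * Q * D) *ᵥ ψ).re + a.re ^ 2 := by
    have h := congrArg Complex.re hdecomp
    rw [Complex.add_re, Complex.add_re, Complex.mul_re, Complex.mul_re, ha_im] at h
    simp only [mul_zero, sub_zero] at h
    rw [h]
    norm_num
    ring
  have hna : ‖a‖ ^ 2 = a.re ^ 2 := by
    rw [Complex.sq_norm, Complex.normSq_apply, ha_im, mul_zero, add_zero, sq]
  rw [hna] at hCS
  have hm1 : 0 ≤ P.trace.re - 1 := htrQ ▸ htrQ0
  rw [hV]
  nlinarith [hCS, hb, hm1, mul_nonneg hm1 hb]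

/-- **Samuelson's inequality for the compression of `Y` to `K`.** For Hermitian `Y`, a subspace
`K ≠ ⊥` with projection matrix `P` (`m = re tr P = dim K`), tracial mean `ȳ = re tr (P Y)/m`
and every unit vector `ψ ∈ K`:
`m · (re ⟨ψ, Y ψ⟩ - ȳ)² ≤ (m - 1) · (re tr (P Y P Y) - m ȳ²)`, i.e. the deviation of any
vector's expectation from the average is at most `√(m-1)` tracial standard deviations of the
compression (`samuelson_core` with `D = P Y P - ȳ P`). Samuelson, JASA 63 (1968) 1522.
[folklore] -/
theorem samuelsonHeadCount (Y : Matrix n n ℂ) (hY : Y.IsHermitian) (K : Submodule ℂ (n → ℂ))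
    (hK : K ≠ ⊥) {ψ : n → ℂ} (hψK : ψ ∈ K) (hψ : star ψ ⬝ᵥ ψ = 1) :
    let P : Matrix n n ℂ := projMatrix (K.map
      ((WithLp.linearEquiv 2 ℂ (n → ℂ)).symm : (n → ℂ) →ₗ[ℂ] EuclideanSpace ℂ n))
    let m : ℝ := P.trace.re
    let ybar : ℝ := (P * Y).trace.re / m
    m * ((star ψ ⬝ᵥ Y *ᵥ ψ).re - ybar) ^ 2 ≤ (m - 1) * ((P * Y * P * Y).trace.re - m * ybar ^ 2) := by
  intro P m ybar
  have hPH : Pᴴ = P := (projMatrix_isHermitian _).eq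
  have hPP : P * P = P := projMatrix_mul_self _
  have hPψ : P *ᵥ ψ = ψ := projMatrix_map_mulVec_of_mem K hψK
  -- `tr P = m = dim K > 0` and `re tr (P Y) = m ȳ`, `tr (P Y)` is real
  have htrP : P.trace = (m : ℂ) := by
    have h : P.trace = (Module.finrank ℂ K : ℂ) := trace_projMatrix_map K
    have hm : m = (Module.finrank ℂ K : ℝ) := by
      show P.trace.re = _
      rw [h, Complex.natCast_re]
    rw [h, hm, Complex.ofReal_natCast]
  have hmpos : 0 < m := by
    have hm : m = (Module.finrank ℂ K : ℝ) := by
      show P.trace.re = _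
      rw [trace_projMatrix_map, Complex.natCast_re]
    rw [hm, Nat.cast_pos]
    exact Module.finrank_pos_iff.mpr (Submodule.nontrivial_iff_ne_bot.mpr hK)
  have hPY : (P * Y).trace.re = m * ybar := by
    show (P * Y).trace.re = m * ((P * Y).trace.re / m)
    field_simp
  have hPYreal : (P * Y).trace = (((P * Y).trace.re : ℝ) : ℂ) := by
    have h : star (P * Y).trace = (P * Y).trace := by
      rw [← trace_conjTranspose, conjTranspose_mul, hPH, hY.eq, trace_mul_comm]
    rw [Complex.star_def] at h
    exact (Complex.conj_eq_iff_re.mp h).symm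
  -- the traceless Hermitian compression `D`, supported on `K`
  set D : Matrix n n ℂ := P * Y * P - (ybar : ℂ) • P with hD
  have hDH : Dᴴ = D := by
    rw [hD, conjTranspose_sub, conjTranspose_smul, conjTranspose_mul, conjTranspose_mul, hPH,
      hY.eq, Complex.star_def, Complex.conj_ofReal, Matrix.mul_assoc]
  have hPD : P * D = D := by
    rw [hD, Matrix.mul_sub, Matrix.mul_smul, ← Matrix.mul_assoc, ← Matrix.mul_assoc, hPP]
  have htr : D.trace = 0 := by
    have t2 : (P * Y * P).trace = (P * Y).trace := by rw [trace_mul_comm, ← Matrix.mul_assoc, hPP]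
    rw [hD, trace_sub, trace_smul, t2, hPYreal, hPY, htrP, smul_eq_mul]
    push_cast
    ring
  have hcore := samuelson_core hPH hPP hDH hPD htr hPψ hψ
  -- (1) `re ⟨ψ, D ψ⟩ = re ⟨ψ, Y ψ⟩ - ȳ`
  have h1 : (star ψ ⬝ᵥ D *ᵥ ψ).re = (star ψ ⬝ᵥ Y *ᵥ ψ).re - ybar := by
    have hadj : ∀ w, star ψ ⬝ᵥ (P *ᵥ w) = star (P *ᵥ ψ) ⬝ᵥ w := fun w => by
      rw [star_mulVec, hPH, ← dotProduct_mulVec]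
    have hPYψ : star ψ ⬝ᵥ (P *ᵥ (Y *ᵥ ψ)) = star ψ ⬝ᵥ (Y *ᵥ ψ) := by rw [hadj, hPψ]
    rw [hD, sub_mulVec, smul_mulVec, ← mulVec_mulVec, ← mulVec_mulVec, hPψ, dotProduct_sub,
      dotProduct_smul, hPYψ, hψ, Complex.sub_re, smul_eq_mul, mul_one, Complex.ofReal_re]
  -- (2) `re tr (D D) = re tr (P Y P Y) - m ȳ²`
  have h2 : (D * D).trace.re = (P * Y * P * Y).trace.re - m * ybar ^ 2 := by
    rw [hD]
    have e1 : P * Y * P * (P * Y * P) = P * Y * P * Y * P := by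
      calc P * Y * P * (P * Y * P) = P * Y * (P * P) * Y * P := by simp only [Matrix.mul_assoc]
        _ = P * Y * P * Y * P := by rw [hPP]
    have e2 : P * Y * P * P = P * Y * P := by rw [Matrix.mul_assoc, hPP]
    have e3 : P * (P * Y * P) = P * Y * P := by rw [← Matrix.mul_assoc, ← Matrix.mul_assoc, hPP]
    have t1 : (P * Y * P * Y * P).trace = (P * Y * P * Y).trace := by
      rw [trace_mul_comm, ← Matrix.mul_assoc, ← Matrix.mul_assoc, ← Matrix.mul_assoc, hPP]
    have t2 : (P * Y * P).trace = (P * Y).trace := by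
      rw [trace_mul_comm, ← Matrix.mul_assoc, hPP]
    simp only [Matrix.sub_mul, Matrix.mul_sub, Matrix.smul_mul, Matrix.mul_smul, e1, e2, e3, hPP,
      trace_sub, trace_smul, t1, t2, smul_eq_mul, Complex.sub_re, Complex.re_ofReal_mul]
    have hPre : P.trace.re = m := rfl
    rw [hPY, hPre]
    ring
  rw [h1, h2] at hcore
  exact hcore

/-- **Moments ⇒ every, Samuelson-sharp form** (`RESHAPE-ideator1.md`, `SamuelsonMinBound`).
For Hermitian `Y` and a subspace `K ≠ ⊥` with projection `P`: the average clause
`c₀ · re tr P ≤ re tr (P Y)` (`c₀ ≥ 0`), the second-moment clause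
`re tr (P Y P Y) · re tr P ≤ (1 + ε) (re tr (P Y))²` (`ε ≥ 0`) and the bounded-degeneracy clause
`re tr P ≤ D` with `ε (D - 1) ≤ 1/4` force `c₀ / 2 ≤ re ⟨ψ, Y ψ⟩` for EVERY unit `ψ ∈ K`
(`samuelsonHeadCount`: `(⟨Y⟩_ψ - ȳ)² ≤ (m - 1) ε ȳ² ≤ ȳ²/4`). Samuelson, JASA 63 (1968) 1522.
[folklore] -/
theorem forall_unit_le_re_of_moments' (Y : Matrix n n ℂ) (hY : Y.IsHermitian)
    (K : Submodule ℂ (n → ℂ)) (hK : K ≠ ⊥) {c₀ ε D : ℝ} (hc₀ : 0 ≤ c₀) (hε : 0 ≤ ε)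
    (hεD : ε * (D - 1) ≤ 1 / 4) :
    let P : Matrix n n ℂ := projMatrix (K.map
      ((WithLp.linearEquiv 2 ℂ (n → ℂ)).symm : (n → ℂ) →ₗ[ℂ] EuclideanSpace ℂ n))
    c₀ * P.trace.re ≤ (P * Y).trace.re →
    (P * Y * P * Y).trace.re * P.trace.re ≤ (1 + ε) * (P * Y).trace.re ^ 2 →
    P.trace.re ≤ D →
    ∀ ψ ∈ K, star ψ ⬝ᵥ ψ = 1 → c₀ / 2 ≤ (star ψ ⬝ᵥ Y *ᵥ ψ).re := by
  intro P havg hmom hdeg ψ hψK hψ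
  have hm : P.trace.re = (Module.finrank ℂ K : ℝ) := by
    show (projMatrix (K.map ((WithLp.linearEquiv 2 ℂ (n → ℂ)).symm :
      (n → ℂ) →ₗ[ℂ] EuclideanSpace ℂ n))).trace.re = _
    rw [trace_projMatrix_map, Complex.natCast_re]
  have hmpos : 0 < P.trace.re := by
    rw [hm, Nat.cast_pos]
    exact Module.finrank_pos_iff.mpr (Submodule.nontrivial_iff_ne_bot.mpr hK)
  have hsam : P.trace.re * ((star ψ ⬝ᵥ Y *ᵥ ψ).re - (P * Y).trace.re / P.trace.re) ^ 2 ≤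
      (P.trace.re - 1) * ((P * Y * P * Y).trace.re -
        P.trace.re * ((P * Y).trace.re / P.trace.re) ^ 2) :=
    samuelsonHeadCount Y hY K hK hψK hψ
  -- write `re tr (P Y) = m ȳ`
  obtain ⟨ybar, hybar⟩ : ∃ ybar : ℝ, (P * Y).trace.re = P.trace.re * ybar :=
    ⟨(P * Y).trace.re / P.trace.re, by field_simp⟩
  have hdiv : (P * Y).trace.re / P.trace.re = ybar := by
    rw [hybar, mul_div_cancel_left₀ _ hmpos.ne']
  rw [hdiv] at hsam
  rw [hybar] at havg hmom
  generalize hmm : P.trace.re = m at *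
  generalize hT : (P * Y * P * Y).trace.re = T at *
  generalize hy : (star ψ ⬝ᵥ Y *ᵥ ψ).re = y at *
  -- `c₀ ≤ ȳ`
  have hyc : c₀ ≤ ybar := le_of_mul_le_mul_left (by linarith [havg]) hmpos
  have hy0 : 0 ≤ ybar := hc₀.trans hyc
  -- the tracial variance is `≤ ε m ȳ²`
  have hTle : T ≤ (1 + ε) * m * ybar ^ 2 := by
    refine le_of_mul_le_mul_right ?_ hmpos
    calc T * m ≤ (1 + ε) * (m * ybar) ^ 2 := hmom
      _ = (1 + ε) * m * ybar ^ 2 * m := by ring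
  have hV : T - m * ybar ^ 2 ≤ ε * m * ybar ^ 2 := by linarith
  -- Samuelson: `m (y - ȳ)² ≤ (m - 1) V ≤ (m - 1) ε m ȳ²`, so `(y - ȳ)² ≤ (D - 1) ε ȳ² ≤ ȳ²/4`
  have hm1 : 0 ≤ m - 1 := by
    rw [hm, sub_nonneg, Nat.one_le_cast]
    exact Module.finrank_pos_iff.mpr (Submodule.nontrivial_iff_ne_bot.mpr hK)
  have hdev : m * (y - ybar) ^ 2 ≤ m * ((m - 1) * ε * ybar ^ 2) := by
    calc m * (y - ybar) ^ 2 ≤ (m - 1) * (T - m * ybar ^ 2) := hsam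
      _ ≤ (m - 1) * (ε * m * ybar ^ 2) := mul_le_mul_of_nonneg_left hV hm1
      _ = m * ((m - 1) * ε * ybar ^ 2) := by ring
  have hdev' : (y - ybar) ^ 2 ≤ (ybar / 2) ^ 2 := by
    have h1 : (y - ybar) ^ 2 ≤ (m - 1) * ε * ybar ^ 2 := le_of_mul_le_mul_left hdev hmpos
    have h2 : (m - 1) * ε * ybar ^ 2 ≤ (D - 1) * ε * ybar ^ 2 :=
      mul_le_mul_of_nonneg_right (mul_le_mul_of_nonneg_right (by linarith) hε) (sq_nonneg _)
    have h3 : (D - 1) * ε * ybar ^ 2 ≤ 1 / 4 * ybar ^ 2 := by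
      have := mul_le_mul_of_nonneg_right hεD (sq_nonneg ybar)
      linarith [this]
    nlinarith [h1, h2, h3]
  have habs : |y - ybar| ≤ ybar / 2 := abs_le_of_sq_le_sq hdev' (by linarith)
  have hlow : -(ybar / 2) ≤ y - ybar := (abs_le.mp habs).1
  linarith

end Samuelson

section Hubbard

/-- **Average + second moment + bounded degeneracy at ONE coupling ⇒ the summit's matrix there,
Samuelson-sharp form** (`RESHAPE-ideator1.md`, items `BirEveryOfMoments` +
`BirBoundedGroundDegeneracy` with its clause `ε (D - 1) ≤ 1/4`): as
`hasLRO_of_groundState_moments`, with `ε (D - 1) ≤ 1/4` in place of `ε D ≤ 1/4`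
(`forall_unit_le_re_of_moments'`). Scalapino, Phys. Rep. 250 (1995) §2; Samuelson (1968).
[folklore] -/
theorem hasLRO_of_groundState_moments' (U δ c ε D : ℝ) (hδ : -1 ≤ δ) (hc : 0 < c) (hε : 0 ≤ ε)
    (hεD : ε * (D - 1) ≤ 1 / 4) (L₀ : ℕ)
    (h : ∀ (L : ℕ) [NeZero L], L₀ ≤ L → Even L →
      let N : ℕ := 2 * ⌊(1 - δ) * (L : ℝ) ^ 2 / 2⌋₊
      let H := hubbardTorus 2 L 1 U
      let S := szSector (Λ := FermionTorus 2 L) N 0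
      let E₀ := S ⊓ Module.End.eigenspace (Matrix.toLin' H) ((H.minEnergyOn S : ℝ) : ℂ)
      let P := projMatrix (E₀.map (Fock.toEuclidean (ι := Orb (FermionTorus 2 L)) :
        Fock (Orb (FermionTorus 2 L)) →ₗ[ℂ] EuclideanSpace ℂ (Finset (Orb (FermionTorus 2 L)))))
      let O := (pairField dWaveFormFactor L)ᴴ * pairField dWaveFormFactor L
      c * (L : ℝ) ^ 4 * P.trace.re ≤ (P * O).trace.re ∧
        (P * O * P * O).trace.re * P.trace.re ≤ (1 + ε) * (P * O).trace.re ^ 2 ∧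
        P.trace.re ≤ D)
    (N : ℕ → ℕ) (ψ : ∀ L, Fock (Orb (FermionTorus 2 L)))
    (hadm : ∀ L, Even L → N L = 2 * ⌊(1 - δ) * (L : ℝ) ^ 2 / 2⌋₊ ∧ star (ψ L) ⬝ᵥ ψ L = 1 ∧
      IsGroundStateInSector (hubbardTorus 2 L 1 U) (N L) 0 (ψ L)) :
    HasLongRangeOrder (fun k => halfOpenBox 2 (2 * k))
      (fun k => torusPullback (pairFieldCorr dWaveFormFactor ψ) (2 * k)) := by
  refine hasLRO_of_forall_groundState_bound U δ (c / 2) (half_pos hc) L₀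
    (fun L _ hL hLe φ hgs hunit => ?_) N ψ hadm
  obtain ⟨havg, hmom, hdeg⟩ := h L hL hLe
  set A : Matrix (Finset (Orb (FermionTorus 2 L))) (Finset (Orb (FermionTorus 2 L))) ℂ :=
    (pairField dWaveFormFactor L)ᴴ * pairField dWaveFormFactor L with hA
  set H := hubbardTorus 2 L 1 U with hH
  set S := szSector (Λ := FermionTorus 2 L) (2 * ⌊(1 - δ) * (L : ℝ) ^ 2 / 2⌋₊) 0 with hS
  set E₀ := S ⊓ Module.End.eigenspace (Matrix.toLin' H) ((H.minEnergyOn S : ℝ) : ℂ) with hE₀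
  rw [map_toEuclidean_eq] at havg hmom hdeg
  have hAH : A.IsHermitian := Matrix.isHermitian_conjTranspose_mul_self _
  have hne : E₀ ≠ ⊥ := hubbardTorus_groundEigenspace_ne_bot 2 L 1 U
    (m := ⌊(1 - δ) * (L : ℝ) ^ 2 / 2⌋₊)
    (by rw [NoGo.card_fermionTorus_two]; exact NoGo.floor_pairNumber_le δ hδ L)
  have hφE : φ ∈ E₀ := by
    refine Submodule.mem_inf.mpr ⟨hgs.1, ?_⟩
    rw [Module.End.mem_eigenspace_iff, Matrix.toLin'_apply]
    exact hgs.2.2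
  have hc0 : 0 ≤ c * (L : ℝ) ^ 4 := by positivity
  have key := forall_unit_le_re_of_moments' A hAH E₀ hne hc0 hε hεD havg hmom hdeg φ hφE hunit
  linarith [key]

/-- **`BirEveryGroundState` ⇐ a moment upgrade of the window average, Samuelson-sharp form**:
as `birEveryGroundState_of_moments`, with the bounded-degeneracy clause `ε (D - 1) ≤ 1/4`.
[folklore] -/
theorem birEveryGroundState_of_moments'
    (h : ∀ (δ U₁ U₂ c : ℝ), δ ∈ Set.Ioo (0:ℝ) (1/2) → 0 < U₁ → U₁ < U₂ → 0 < c →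
      (∀ U ∈ Set.Ioo U₁ U₂, ∃ L₀ : ℕ, ∀ (L : ℕ) [NeZero L], L₀ ≤ L → Even L →
        let N : ℕ := 2 * ⌊(1 - δ) * (L : ℝ) ^ 2 / 2⌋₊
        let H := hubbardTorus 2 L 1 U
        let S := szSector (Λ := FermionTorus 2 L) N 0
        let E₀ := S ⊓ Module.End.eigenspace (Matrix.toLin' H) ((H.minEnergyOn S : ℝ) : ℂ)
        let P := projMatrix (E₀.map (Fock.toEuclidean (ι := Orb (FermionTorus 2 L)) :
          Fock (Orb (FermionTorus 2 L)) →ₗ[ℂ] EuclideanSpace ℂ (Finset (Orb (FermionTorus 2 L)))))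
        c * (L : ℝ) ^ 4 * P.trace.re ≤
          (P * ((pairField dWaveFormFactor L)ᴴ * pairField dWaveFormFactor L)).trace.re) →
      ∃ U ∈ Set.Ioo U₁ U₂, ∃ c' ε D : ℝ, 0 < c' ∧ 0 ≤ ε ∧ ε * (D - 1) ≤ 1 / 4 ∧
        ∃ L₀ : ℕ, ∀ (L : ℕ) [NeZero L], L₀ ≤ L → Even L →
        let N : ℕ := 2 * ⌊(1 - δ) * (L : ℝ) ^ 2 / 2⌋₊
        let H := hubbardTorus 2 L 1 U
        let S := szSector (Λ := FermionTorus 2 L) N 0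
        let E₀ := S ⊓ Module.End.eigenspace (Matrix.toLin' H) ((H.minEnergyOn S : ℝ) : ℂ)
        let P := projMatrix (E₀.map (Fock.toEuclidean (ι := Orb (FermionTorus 2 L)) :
          Fock (Orb (FermionTorus 2 L)) →ₗ[ℂ] EuclideanSpace ℂ (Finset (Orb (FermionTorus 2 L)))))
        let O := (pairField dWaveFormFactor L)ᴴ * pairField dWaveFormFactor L
        c' * (L : ℝ) ^ 4 * P.trace.re ≤ (P * O).trace.re ∧
          (P * O * P * O).trace.re * P.trace.re ≤ (1 + ε) * (P * O).trace.re ^ 2 ∧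
          P.trace.re ≤ D) :
    BirEveryGroundState := by
  intro δ U₁ U₂ c hδ hU₁ hU₁₂ hc hyp
  obtain ⟨U, hU, c', ε, D, hc', hε, hεD, L₀, hL₀⟩ := h δ U₁ U₂ c hδ hU₁ hU₁₂ hc hyp
  have hδ' : (-1 : ℝ) ≤ δ := by linarith [hδ.1]
  exact ⟨U, hU, fun N ψ hadm =>
    hasLRO_of_groundState_moments' U δ c' ε D hδ' hc' hε hεD L₀
      (fun L _ hL hLe => hL₀ L hL hLe) N ψ hadm⟩

end Hubbard

end Summit.HubbardSuperconductivity.HubbardSuperconductivity.Theorems
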